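import Summits.BirchSwinnertonDyer.BirchSwinnertonDyer.Theorems.ClassRecordThreeEulerHalvesAtThreeCartanCorrespondenceCubicSumRegimes
import Mathlib.NumberTheory.LegendreSymbol.Basic
import Mathlib.Algebra.QuadraticDiscriminant
import Mathlib.Algebra.Polynomial.Roots
import HarnessLib

/-!
# The axis count law `CubicAxisCountAtThree` — PROVED (the involution `t ↦ D/t`)

Helper file riding `--supports stmt-BirchSwinnertonDyer-19109` (crux `EulerHalvesAtThree`; UNREGISTERED sub-line
`Cruxes/EulerHalvesAtThree/Lines/cartan_corr`, seat `bsd-idea-10` g12). It CLOSES the node `CubicAxisCountAtThree` of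
`Theorems/ClassRecordThreeEulerHalvesAtThreeCartanCorrespondenceCubicSumRegimes.lean` and hence (`sumNormAxis_of_axisCount`) the `3·□` law
`CubicSumNormAxisAtThree`: for every prime `q ≡ 1 (3)` and every irreducible `Q = x² + bx + c` over `𝔽_q`, `|Σ_Q|² = 3n²` — the cubic character
sum `Σ_Q = Σ_{x≠0} θ(Q(x)/x)` lies on an axis `(1−ω)μ₆ℤ` of `ℤ[ω]`. With `cubicSumNormThreeDvd` this makes the elementary count law
`CubicClassCountLawAtThree` (U♯ at the principal-series places) literally the statement «some irreducible `Q` has `3 ∤ n_Q`».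
HONEST FRAMING: the count law itself stays OPEN (residual class `R`, Regimes file); no crux, no route item, no registered stub is proved; BSD is
proved for no curve.

## Proof (elementary; module docstring of the Regimes file, item 1)
Fibre the set `X = {x ≠ 0 : D·Q(x)/x is a cube}` over `t = Q(x)/x`: the fibre over `t` is the root set of `x² + (b−t)x + c`, and `x ∈ X` iff
`t ∈ S := {t ≠ 0 : (Dt)^e = 1}` (`e = (q−1)/3`). The map `t ↦ D/t` is an involution of `S`, and the discriminants satisfy
`Δ(D/t) = (D/t²)·Δ(t)` with `D` a NON-square, so the root counts pair up: `N(t) + N(D/t) = 2` (square ↔ non-square, zero ↔ zero). Hence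
`2·#X = Σ_{t∈S}(N(t) + N(D/t)) = 2·#S`, and `#S = e` because the three classes `{(Dt)^e = ζ^j}` are permuted cyclically by `t ↦ λt` with
`λ^e = ζ` (such `λ` exists: otherwise `X^e − 1` would have `q − 1 > e` roots) and partition `𝔽_q^×`. Ingredients: `quadratic_eq_zero_iff`,
`ZMod.euler_criterion`, `Polynomial.card_nthRoots`, `Finset.card_eq_sum_card_fiberwise`, `Finset.sum_nbij'`. [folklore]
-/

set_option linter.dupNamespace false
set_option autoImplicit false

namespace Summit.BirchSwinnertonDyer.BirchSwinnertonDyer.Theorems.CartanCorrespondence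

/-! ## §1 Root counts of monic quadratics over `ZMod q` -/

/-- The number of roots in `ZMod q` of the monic quadratic `x² + p·x + r`. -/
def quadRootCount (q : ℕ) [NeZero q] (p r : ZMod q) : ℕ :=
  (Finset.univ.filter (fun x : ZMod q => x ^ 2 + p * x + r = 0)).card

/-- PROVED: `ζ^n = ζ^(n mod 3)` for a cube root of unity. [folklore] -/
theorem zeta_pow_mod_three {R : Type*} [Monoid R] {ζ : R} (hζ3 : ζ ^ 3 = 1) (n : ℕ) : ζ ^ n = ζ ^ (n % 3) := by
  conv_lhs => rw [← Nat.div_add_mod n 3, pow_add, pow_mul, hζ3, one_pow, one_mul]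

variable {q : ℕ} [hq : Fact q.Prime]

/-- PROVED: `2 ≠ 0` in `ZMod q` for a prime `q ≡ 1 (3)`. [folklore] -/
theorem two_ne_zero_of_mod_three (h1 : q % 3 = 1) : (2 : ZMod q) ≠ 0 := by
  intro h
  have h' : ((2 : ℕ) : ZMod q) = 0 := by exact_mod_cast h
  rw [ZMod.natCast_eq_zero_iff] at h'
  have hle := Nat.le_of_dvd (by norm_num) h'
  have h2 := hq.out.two_le
  interval_cases q; omega

/-- PROVED: a monic quadratic with non-square discriminant has no root. [folklore] -/
theorem quadRootCount_eq_zero {p r : ZMod q} (h : ¬ IsSquare (p ^ 2 - 4 * r)) : quadRootCount q p r = 0 := by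
  unfold quadRootCount
  rw [Finset.card_eq_zero, Finset.filter_eq_empty_iff]
  intro x _ hx
  have hd : ∀ s : ZMod q, discrim 1 p r ≠ s ^ 2 := by
    intro s hs
    apply h
    exact ⟨s, by rw [← sq, ← hs, discrim]; ring⟩
  exact quadratic_ne_zero_of_discrim_ne_sq hd x (by linear_combination hx)

/-- PROVED: a monic quadratic with zero discriminant has exactly one root (`q` odd). [folklore] -/
theorem quadRootCount_eq_one (h1 : q % 3 = 1) {p r : ZMod q} (h : p ^ 2 - 4 * r = 0) : quadRootCount q p r = 1 := by
  haveI : NeZero (2 : ZMod q) := ⟨two_ne_zero_of_mod_three h1⟩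
  unfold quadRootCount
  rw [Finset.card_eq_one]
  refine ⟨-p / (2 * 1), ?_⟩
  ext x
  simp only [Finset.mem_filter, Finset.mem_univ, true_and, Finset.mem_singleton]
  have hd : discrim 1 p r = 0 := by rw [discrim]; linear_combination h
  rw [← quadratic_eq_zero_iff_of_discrim_eq_zero one_ne_zero hd x]
  constructor <;> intro hx <;> linear_combination hx

/-- PROVED: a monic quadratic whose discriminant is a NONZERO square has exactly two roots (`q` odd). [folklore] -/
theorem quadRootCount_eq_two (h1 : q % 3 = 1) {p r s : ZMod q} (h : p ^ 2 - 4 * r = s ^ 2) (hs : s ≠ 0) :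
    quadRootCount q p r = 2 := by
  haveI : NeZero (2 : ZMod q) := ⟨two_ne_zero_of_mod_three h1⟩
  have h2 : (2 * 1 : ZMod q) ≠ 0 := by rw [mul_one]; exact two_ne_zero_of_mod_three h1
  unfold quadRootCount
  have hd : discrim 1 p r = s * s := by rw [discrim, ← sq]; linear_combination h
  have hset : Finset.univ.filter (fun x : ZMod q => x ^ 2 + p * x + r = 0) = {(-p + s) / (2 * 1), (-p - s) / (2 * 1)} := by
    ext x
    simp only [Finset.mem_filter, Finset.mem_univ, true_and, Finset.mem_insert, Finset.mem_singleton]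
    rw [← quadratic_eq_zero_iff one_ne_zero hd x]
    constructor <;> intro hx <;> linear_combination hx
  rw [hset, Finset.card_pair]
  intro heq
  rw [div_eq_div_iff h2 h2] at heq
  have h4 : (2 * 2 : ZMod q) * s = 0 := by linear_combination heq
  rcases mul_eq_zero.mp h4 with h22 | hs0
  · rcases mul_eq_zero.mp h22 with h0 | h0 <;> exact two_ne_zero_of_mod_three h1 h0
  · exact hs hs0

/-- PROVED: the product of two non-squares of `𝔽_q^×` is a square (Euler's criterion). [folklore] -/
theorem isSquare_mul_of_nonsquares {a b : ZMod q} (ha : a ≠ 0) (hb : b ≠ 0) (hna : ¬ IsSquare a) (hnb : ¬ IsSquare b) :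
    IsSquare (a * b) := by
  rw [ZMod.euler_criterion q (mul_ne_zero ha hb), mul_pow]
  have ha' := (ZMod.pow_div_two_eq_neg_one_or_one q ha).resolve_left (fun h => hna ((ZMod.euler_criterion q ha).mpr h))
  have hb' := (ZMod.pow_div_two_eq_neg_one_or_one q hb).resolve_left (fun h => hnb ((ZMod.euler_criterion q hb).mpr h))
  rw [ha', hb']; ring

/-- PROVED: a non-square times a nonzero square is a non-square. [folklore] -/
theorem not_isSquare_mul_sq {a u : ZMod q} (hna : ¬ IsSquare a) (hu : u ≠ 0) : ¬ IsSquare (a * u ^ 2) := by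
  rintro ⟨w, hw⟩
  apply hna
  refine ⟨w * u⁻¹, ?_⟩
  calc a = a * u ^ 2 * (u⁻¹) ^ 2 := by rw [mul_assoc, ← mul_pow, mul_inv_cancel₀ hu, one_pow, mul_one]
    _ = w * w * (u⁻¹) ^ 2 := by rw [hw]
    _ = w * u⁻¹ * (w * u⁻¹) := by ring

/-- PROVED — **THE PAIRING**: for a non-square `D = b² − 4c` and `t ≠ 0` the root counts of `x² + (b−t)x + c` and `x² + (b − D/t)x + c`
add up to `2` (their discriminants differ by the non-square factor `D/t²`). [folklore] -/
theorem quadRootCount_pair (h1 : q % 3 = 1) {b c t : ZMod q} (hD : ¬ IsSquare (b ^ 2 - 4 * c)) (ht : t ≠ 0) :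
    quadRootCount q (b - t) c + quadRootCount q (b - (b ^ 2 - 4 * c) * t⁻¹) c = 2 := by
  have hD0 : b ^ 2 - 4 * c ≠ 0 := fun h => hD ⟨0, by rw [h, mul_zero]⟩
  have hti : t * t⁻¹ = 1 := mul_inv_cancel₀ ht
  have hΔ' : (b - (b ^ 2 - 4 * c) * t⁻¹) ^ 2 - 4 * c = ((b ^ 2 - 4 * c) * (t⁻¹) ^ 2) * ((b - t) ^ 2 - 4 * c) := by
    linear_combination (-(b ^ 2 - 4 * c) * (1 + t * t⁻¹ - 2 * b * t⁻¹)) * hti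
  rcases eq_or_ne ((b - t) ^ 2 - 4 * c) 0 with hz | hnz
  · have hz' : (b - (b ^ 2 - 4 * c) * t⁻¹) ^ 2 - 4 * c = 0 := by rw [hΔ', hz, mul_zero]
    rw [quadRootCount_eq_one h1 hz, quadRootCount_eq_one h1 hz']
  · by_cases hsq : IsSquare ((b - t) ^ 2 - 4 * c)
    · obtain ⟨s, hs⟩ := hsq
      have hs0 : s ≠ 0 := by rintro rfl; exact hnz (by rw [hs, mul_zero])
      have hΔ2 : (b - t) ^ 2 - 4 * c = s ^ 2 := by rw [hs, sq]
      have hns : ¬ IsSquare ((b - (b ^ 2 - 4 * c) * t⁻¹) ^ 2 - 4 * c) := by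
        rw [hΔ', hΔ2, show (b ^ 2 - 4 * c) * (t⁻¹) ^ 2 * s ^ 2 = (b ^ 2 - 4 * c) * (s * t⁻¹) ^ 2 by ring]
        exact not_isSquare_mul_sq hD (mul_ne_zero hs0 (inv_ne_zero ht))
      rw [quadRootCount_eq_two h1 hΔ2 hs0, quadRootCount_eq_zero hns]
    · obtain ⟨w, hw⟩ := isSquare_mul_of_nonsquares hD0 hnz hD hsq
      have hw0 : w ≠ 0 := by rintro rfl; exact (mul_ne_zero hD0 hnz) (by rw [hw, mul_zero])
      have hΔ2 : (b - (b ^ 2 - 4 * c) * t⁻¹) ^ 2 - 4 * c = (w * t⁻¹) ^ 2 := by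
        rw [hΔ', show (b ^ 2 - 4 * c) * (t⁻¹) ^ 2 * ((b - t) ^ 2 - 4 * c) = ((b ^ 2 - 4 * c) * ((b - t) ^ 2 - 4 * c)) * (t⁻¹) ^ 2 by ring,
          hw]
        ring
      rw [quadRootCount_eq_zero hsq, quadRootCount_eq_two h1 hΔ2 (mul_ne_zero hw0 (inv_ne_zero ht))]

/-! ## §2 The class `S = {t ≠ 0 : (Dt)^e = 1}` has exactly `e = (q−1)/3` elements -/

/-- PROVED: some `λ ∈ 𝔽_q^×` has `λ^e = ζ` (else `X^e − 1` would have `q − 1 > e` roots). [folklore] -/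
theorem exists_pow_third_eq_zeta (h1 : q % 3 = 1) {ζ : ZMod q} (hζ3 : ζ ^ 3 = 1) (hζ1 : ζ ≠ 1) :
    ∃ l : ZMod q, l ≠ 0 ∧ l ^ ((q - 1) / 3) = ζ := by
  classical
  by_contra hne
  simp only [not_exists, not_and] at hne
  have hall : ∀ l : ZMod q, l ≠ 0 → l ^ ((q - 1) / 3) = 1 := by
    intro l hl
    rcases cubeClass_trichotomy h1 hζ3 hζ1 one_ne_zero hl with h | h | h
    · simpa using h
    · exact absurd (by simpa using h) (hne l hl)
    · exfalso
      have h' : l ^ ((q - 1) / 3) = ζ ^ 2 := by simpa using h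
      apply hne (l ^ 2) (pow_ne_zero 2 hl)
      rw [← pow_mul, mul_comm, pow_mul, h', ← pow_mul, show 2 * 2 = 3 + 1 from rfl, pow_add, hζ3, one_mul, pow_one]
  have h2 := hq.out.two_le
  have hpos : 0 < (q - 1) / 3 := by omega
  have hsub : Finset.univ.erase (0 : ZMod q) ⊆ (Polynomial.nthRoots ((q - 1) / 3) (1 : ZMod q)).toFinset := by
    intro l hl
    rw [Multiset.mem_toFinset, Polynomial.mem_nthRoots hpos]
    exact hall l (Finset.ne_of_mem_erase hl)
  have hcard := Finset.card_le_card hsub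
  rw [Finset.card_erase_of_mem (Finset.mem_univ _), Finset.card_univ, ZMod.card] at hcard
  have hle := (Multiset.toFinset_card_le _).trans (Polynomial.card_nthRoots ((q - 1) / 3) (1 : ZMod q))
  omega

/-- PROVED: multiplication by `λ` (`λ^e = ζ`) carries the class `{(Dt)^e = ζ^j}` onto the class `{(Dt)^e = ζ^(j+1)}`. [folklore] -/
theorem card_class_succ (h1 : q % 3 = 1) {ζ : ZMod q} (hζ3 : ζ ^ 3 = 1) (hζ1 : ζ ≠ 1) (D : ZMod q) (j : ℕ) :
    (Finset.univ.filter (fun t : ZMod q => t ≠ 0 ∧ (D * t) ^ ((q - 1) / 3) = ζ ^ j)).card =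
      (Finset.univ.filter (fun t : ZMod q => t ≠ 0 ∧ (D * t) ^ ((q - 1) / 3) = ζ ^ ((j + 1) % 3))).card := by
  classical
  obtain ⟨l, hl0, hle⟩ := exists_pow_third_eq_zeta h1 hζ3 hζ1
  have hζ0 : ζ ≠ 0 := by rintro rfl; norm_num at hζ3
  apply Finset.card_nbij' (fun t => l * t) (fun t => l⁻¹ * t)
  · intro t ht
    simp only [Finset.coe_filter, Finset.mem_univ, true_and, Set.mem_setOf_eq] at ht ⊢
    refine ⟨mul_ne_zero hl0 ht.1, ?_⟩
    rw [show D * (l * t) = l * (D * t) by ring, mul_pow, hle, ht.2, ← pow_succ', zeta_pow_mod_three hζ3 (j + 1)]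
  · intro t ht
    simp only [Finset.coe_filter, Finset.mem_univ, true_and, Set.mem_setOf_eq] at ht ⊢
    refine ⟨mul_ne_zero (inv_ne_zero hl0) ht.1, ?_⟩
    rw [show D * (l⁻¹ * t) = l⁻¹ * (D * t) by ring, mul_pow, inv_pow, hle, ht.2, ← zeta_pow_mod_three hζ3 (j + 1), pow_succ,
      mul_comm (ζ ^ j) ζ, ← mul_assoc, inv_mul_cancel₀ hζ0, one_mul]
  · intro t _
    simp only
    rw [← mul_assoc, inv_mul_cancel₀ hl0, one_mul]
  · intro t _
    simp only
    rw [← mul_assoc, mul_inv_cancel₀ hl0, one_mul]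

/-- PROVED: the three classes `{t ≠ 0 : (Dt)^e = ζ^j}`, `j = 0,1,2`, partition `𝔽_q^×` (`D ≠ 0`). [folklore] -/
theorem card_classes_sum (h1 : q % 3 = 1) {ζ : ZMod q} (hζ3 : ζ ^ 3 = 1) (hζ1 : ζ ≠ 1) {D : ZMod q} (hD0 : D ≠ 0) :
    (Finset.univ.filter (fun t : ZMod q => t ≠ 0 ∧ (D * t) ^ ((q - 1) / 3) = ζ ^ 0)).card +
      (Finset.univ.filter (fun t : ZMod q => t ≠ 0 ∧ (D * t) ^ ((q - 1) / 3) = ζ ^ 1)).card +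
      (Finset.univ.filter (fun t : ZMod q => t ≠ 0 ∧ (D * t) ^ ((q - 1) / 3) = ζ ^ 2)).card = q - 1 := by
  classical
  set T : ℕ → Finset (ZMod q) := fun k =>
    Finset.univ.filter (fun t : ZMod q => t ≠ 0 ∧ (D * t) ^ ((q - 1) / 3) = ζ ^ k) with hT
  show (T 0).card + (T 1).card + (T 2).card = q - 1
  have hdisj : ∀ j k, j < 3 → k < 3 → j ≠ k → Disjoint (T j) (T k) := by
    intro j k hj hk hjk
    rw [hT, Finset.disjoint_filter]
    rintro x - ⟨_, hxj⟩ ⟨-, hxk⟩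
    exact hjk (pow_injective_of_primitiveCubeRoot hζ3 hζ1 hj hk (hxj.symm.trans hxk))
  have hunion : T 0 ∪ T 1 ∪ T 2 = Finset.univ.filter (fun x : ZMod q => x ≠ 0) := by
    ext x
    simp only [hT, Finset.mem_union, Finset.mem_filter, Finset.mem_univ, true_and]
    constructor
    · rintro ((⟨hx, -⟩ | ⟨hx, -⟩) | ⟨hx, -⟩) <;> exact hx
    · intro hx
      rcases cubeClass_trichotomy h1 hζ3 hζ1 one_ne_zero (mul_ne_zero hD0 hx) with h | h | h
      · exact Or.inl (Or.inl ⟨hx, by rw [h, one_pow, mul_one]⟩)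
      · exact Or.inl (Or.inr ⟨hx, by rw [h, one_pow, mul_one]⟩)
      · exact Or.inr ⟨hx, by rw [h, one_pow, mul_one]⟩
  have hcard : (Finset.univ.filter (fun x : ZMod q => x ≠ 0)).card = q - 1 := by
    rw [Finset.filter_ne' Finset.univ (0 : ZMod q), Finset.card_erase_of_mem (Finset.mem_univ _), Finset.card_univ, ZMod.card]
  have hd01 := hdisj 0 1 (by norm_num) (by norm_num) (by norm_num)
  have hd02 := hdisj 0 2 (by norm_num) (by norm_num) (by norm_num)
  have hd12 := hdisj 1 2 (by norm_num) (by norm_num) (by norm_num)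
  rw [← hcard, ← hunion, Finset.card_union_of_disjoint (Finset.disjoint_union_left.mpr ⟨hd02, hd12⟩),
    Finset.card_union_of_disjoint hd01]

/-- PROVED: `#{t ≠ 0 : (Dt)^e = 1} = (q−1)/3` for `D ≠ 0`. [folklore] -/
theorem card_class_zero (h1 : q % 3 = 1) {ζ : ZMod q} (hζ3 : ζ ^ 3 = 1) (hζ1 : ζ ≠ 1) {D : ZMod q} (hD0 : D ≠ 0) :
    (Finset.univ.filter (fun t : ZMod q => t ≠ 0 ∧ (D * t) ^ ((q - 1) / 3) = 1)).card = (q - 1) / 3 := by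
  have hsum := card_classes_sum h1 hζ3 hζ1 hD0
  have h01 := card_class_succ h1 hζ3 hζ1 D 0
  have h12 := card_class_succ h1 hζ3 hζ1 D 1
  rw [show (0 + 1) % 3 = 1 from rfl] at h01
  rw [show (1 + 1) % 3 = 2 from rfl] at h12
  rw [pow_zero] at hsum h01
  omega

/-! ## §3 The axis count law -/

/-- PROVED: the class bookkeeping — `ζ^m·u = 1 ↔ u = ζ^(2m mod 3)` for `u` with… (stated for the two directions actually used). [folklore] -/
theorem eq_pow_of_zeta_pow_mul_eq_one {ζ u : ZMod q} (hζ3 : ζ ^ 3 = 1) {m : ℕ} (h : ζ ^ m * u = 1) : u = ζ ^ (2 * m % 3) := by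
  have : u = ζ ^ (2 * m) * (ζ ^ m * u) := by
    rw [← mul_assoc, ← pow_add, show 2 * m + m = 3 * m by ring, pow_mul, hζ3, one_pow, one_mul]
  rw [h, mul_one] at this
  rw [this, zeta_pow_mod_three hζ3]

/-- PROVED: … and conversely. [folklore] -/
theorem zeta_pow_mul_eq_one_of_eq_pow {ζ u : ZMod q} (hζ3 : ζ ^ 3 = 1) {m : ℕ} (h : u = ζ ^ (2 * m % 3)) : ζ ^ m * u = 1 := by
  rw [h, ← pow_add, zeta_pow_mod_three hζ3 (m + 2 * m % 3), show (m + 2 * m % 3) % 3 = 0 by omega, pow_zero]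

/-- PROVED — **THE AXIS COUNT LAW** `CubicAxisCountAtThree` BY NAME: for irreducible `Q = x² + bx + c` over `𝔽_q` (`q ≡ 1 (3)` prime) with
`disc(Q)^e = ζ^m`, exactly `(q−1)/3` of the `x ∈ 𝔽_q^×` have `Q(x)/x` in the cubic class `−m`. [folklore] -/
theorem cubicAxisCount : CubicAxisCountAtThree := by
  intro q hF h1 ζ hζ3 hζ1 b c m hD hDm
  classical
  have hD0 : b ^ 2 - 4 * c ≠ 0 := fun h => hD ⟨0, by rw [h, mul_zero]⟩
  have hc0 : c ≠ 0 := by rintro rfl; exact hD ⟨b, by ring⟩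
  have hirr : ∀ x : ZMod q, 1 * x ^ 2 + b * x + c ≠ 0 := fun x hx => hD ⟨2 * x + b, by linear_combination (-4 : ZMod q) * hx⟩
  have hD3 : (b ^ 2 - 4 * c) ^ (3 * ((q - 1) / 3)) = 1 := by
    rw [Nat.mul_comm 3 ((q - 1) / 3), pow_mul, hDm, ← pow_mul, Nat.mul_comm m 3, pow_mul, hζ3, one_pow]
  -- the fibration `x ↦ t = Q(x)/x` over `S = {t ≠ 0 : (Dt)^e = 1}`
  have hmaps : ∀ x ∈ Finset.univ.filter (fun x : ZMod q => x ≠ 0 ∧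
      (1 * x ^ 2 + b * x + c) ^ ((q - 1) / 3) = ζ ^ (2 * m % 3) * x ^ ((q - 1) / 3)),
      (1 * x ^ 2 + b * x + c) * x⁻¹ ∈ Finset.univ.filter (fun t : ZMod q => t ≠ 0 ∧ ((b ^ 2 - 4 * c) * t) ^ ((q - 1) / 3) = 1) := by
    intro x hx
    simp only [Finset.mem_filter, Finset.mem_univ, true_and] at hx ⊢
    refine ⟨mul_ne_zero (hirr x) (inv_ne_zero hx.1), ?_⟩
    rw [mul_pow, mul_pow, hDm, hx.2, inv_pow, mul_assoc, mul_inv_cancel₀ (pow_ne_zero _ hx.1), mul_one]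
    exact zeta_pow_mul_eq_one_of_eq_pow hζ3 rfl
  unfold cubicClassCount
  rw [Finset.card_eq_sum_card_fiberwise (fun x hx => hmaps x (Finset.mem_coe.mp hx))]
  -- each fibre is the root set of `x² + (b − t)x + c`
  have hfib : ∀ t ∈ Finset.univ.filter (fun t : ZMod q => t ≠ 0 ∧ ((b ^ 2 - 4 * c) * t) ^ ((q - 1) / 3) = 1),
      ((Finset.univ.filter (fun x : ZMod q => x ≠ 0 ∧
        (1 * x ^ 2 + b * x + c) ^ ((q - 1) / 3) = ζ ^ (2 * m % 3) * x ^ ((q - 1) / 3))).filter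
        (fun x => (1 * x ^ 2 + b * x + c) * x⁻¹ = t)).card = quadRootCount q (b - t) c := by
    intro t ht
    simp only [Finset.mem_filter, Finset.mem_univ, true_and] at ht
    unfold quadRootCount
    congr 1
    ext x
    simp only [Finset.mem_filter, Finset.mem_univ, true_and]
    constructor
    · rintro ⟨⟨hx0, -⟩, hxt⟩
      have hQ : 1 * x ^ 2 + b * x + c = t * x := by
        rw [← hxt, mul_assoc, inv_mul_cancel₀ hx0, mul_one]
      linear_combination hQ
    · intro hx
      have hx0 : x ≠ 0 := by rintro rfl; apply hc0; simpa using hx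
      have hQ : 1 * x ^ 2 + b * x + c = t * x := by linear_combination hx
      have hte : t ^ ((q - 1) / 3) = ζ ^ (2 * m % 3) := by
        apply eq_pow_of_zeta_pow_mul_eq_one hζ3
        rw [← hDm, ← mul_pow]; exact ht.2
      refine ⟨⟨hx0, ?_⟩, ?_⟩
      · rw [hQ, mul_pow, hte]
      · rw [hQ, mul_assoc, mul_inv_cancel₀ hx0, mul_one]
  rw [Finset.sum_congr rfl hfib]
  -- the involution `t ↦ D/t` on `S`
  have hinv : ∀ t : ZMod q, t ≠ 0 → (b ^ 2 - 4 * c) * ((b ^ 2 - 4 * c) * t⁻¹)⁻¹ = t := by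
    intro t ht
    rw [mul_inv, inv_inv, ← mul_assoc, mul_inv_cancel₀ hD0, one_mul]
  have hmem : ∀ t ∈ Finset.univ.filter (fun t : ZMod q => t ≠ 0 ∧ ((b ^ 2 - 4 * c) * t) ^ ((q - 1) / 3) = 1),
      (b ^ 2 - 4 * c) * t⁻¹ ∈ Finset.univ.filter (fun t : ZMod q => t ≠ 0 ∧ ((b ^ 2 - 4 * c) * t) ^ ((q - 1) / 3) = 1) := by
    intro t ht
    simp only [Finset.mem_filter, Finset.mem_univ, true_and] at ht ⊢
    refine ⟨mul_ne_zero hD0 (inv_ne_zero ht.1), ?_⟩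
    have hte : ζ ^ m * t ^ ((q - 1) / 3) = 1 := by rw [← hDm, ← mul_pow]; exact ht.2
    rw [mul_pow, mul_pow, inv_pow, hDm, ← eq_inv_of_mul_eq_one_left hte, ← pow_add, ← pow_add,
      zeta_pow_mod_three hζ3 (m + (m + m)), show (m + (m + m)) % 3 = 0 by omega, pow_zero]
  have hswap : ∑ t ∈ Finset.univ.filter (fun t : ZMod q => t ≠ 0 ∧ ((b ^ 2 - 4 * c) * t) ^ ((q - 1) / 3) = 1),
      quadRootCount q (b - t) c =
      ∑ t ∈ Finset.univ.filter (fun t : ZMod q => t ≠ 0 ∧ ((b ^ 2 - 4 * c) * t) ^ ((q - 1) / 3) = 1),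
      quadRootCount q (b - (b ^ 2 - 4 * c) * t⁻¹) c := by
    apply Finset.sum_nbij' (fun t => (b ^ 2 - 4 * c) * t⁻¹) (fun t => (b ^ 2 - 4 * c) * t⁻¹) hmem hmem
    · intro t ht
      simp only [Finset.mem_filter, Finset.mem_univ, true_and] at ht
      exact hinv t ht.1
    · intro t ht
      simp only [Finset.mem_filter, Finset.mem_univ, true_and] at ht
      exact hinv t ht.1
    · intro t ht
      simp only [Finset.mem_filter, Finset.mem_univ, true_and] at ht
      simp only [hinv t ht.1]
  -- pair up and count
  have hpair : ∑ t ∈ Finset.univ.filter (fun t : ZMod q => t ≠ 0 ∧ ((b ^ 2 - 4 * c) * t) ^ ((q - 1) / 3) = 1),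
      (quadRootCount q (b - t) c + quadRootCount q (b - (b ^ 2 - 4 * c) * t⁻¹) c) =
      ∑ t ∈ Finset.univ.filter (fun t : ZMod q => t ≠ 0 ∧ ((b ^ 2 - 4 * c) * t) ^ ((q - 1) / 3) = 1), 2 := by
    apply Finset.sum_congr rfl
    intro t ht
    simp only [Finset.mem_filter, Finset.mem_univ, true_and] at ht
    exact quadRootCount_pair h1 hD ht.1
  rw [Finset.sum_add_distrib, ← hswap, Finset.sum_const, smul_eq_mul, card_class_zero h1 hζ3 hζ1 hD0] at hpair
  omega

/-- PROVED — the `3·□` LAW `CubicSumNormAxisAtThree` BY NAME: `|Σ_Q|² = 3n²` for every irreducible binary form over `𝔽_q`, `q ≡ 1 (3)`. [folklore] -/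
theorem cubicSumNormAxis : CubicSumNormAxisAtThree := sumNormAxis_of_axisCount cubicAxisCount

end Summit.BirchSwinnertonDyer.BirchSwinnertonDyer.Theorems.CartanCorrespondence
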